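import Mathlib
import Literature.Analysis.FluidPDE.LocalTrilinearSkew
import Literature.Analysis.FluidPDE.WeakGradientIBP
import Summits.NavierStokesRegularity.NavierStokesRegularity.Theorems.EulerZoomLiouvillePowerGaugeEulerLiouvilleWeakBernoulliTransportTools
import HarnessLib

/-!
# CIV (3.3) IN THE WEAK CLASS, I: the two transport terms integrated by parts once more
# (crux `EulerZoomLiouville.PowerGaugeEulerLiouville` = stmt-NavierStokesRegularity-19832, line `birth`, open stub `stub_selfSimilarWeakRest`)

Width seat `ns-ezl-w1` (g6) under the crux LEAD, cell ns-regularity-ideate.  TOOL for the genuinely weak exactly-self-similar stratum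
(sequel of `…WeakBernoulliTransport*`: there CIV (3.31) in `𝒟′`, here CIV (3.3) itself in non-divergence form).

The lineage transfers the Euler identity of a weak class member to its profile in DIVERGENCE form
(`ProfileEquation.weak_profile_equation`): for every test field `ψ`,
`∫ ⟪V,(V·∇)ψ⟫ + P div ψ + γ⟪V,(y·∇)ψ⟫ + (4γ−1)⟪V,ψ⟫ = 0`.  Since a class profile has a whole-space weak gradient
`G ∈ L²_loc` (the `E`-gauge) and `V ∈ L⁶_loc`, the two transport terms can be integrated by parts ONCE MORE, which puts the
profile equation in NON-DIVERGENCE form and exhibits the weak gradient of the pressure: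
`∇P = −(1−γ)V − G(W)`, `W = γy + V` — CIV (3.3) POINTWISE A.E., `P ∈ W^{1,1}_loc` (indeed `W^{1,3/2}_loc`), NO regularity assumed.
Chain of three files: `…WeakPressureGradientTools` ((N1), (N2)), `…WeakPressureGradient` ((N3), (N4)), `…WeakPressureGradientMember`.

THIS FILE:
* (N1) `WeakPressure.integral_inner_fderiv_apply_self` — `∫⟪V, Dψ(V)⟫ = −∫⟪G(V), ψ⟫` (two rough factors: the tree's local Serrin
  skew identity `Literature.Analysis.FluidPDE.integral_fderiv_apply_mul_inner_add_eq_zero` with `b = c = V`, `d` constant, summed over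
  an orthonormal frame);
* (N2) `WeakPressure.integral_inner_fderiv_apply_id` — `∫⟪V, Dψ(y)⟫ = −3∫⟪V,ψ⟫ − ∫⟪G(y), ψ⟫`
  (`HasWeakGradient.integral_inner_fderiv_apply_test` with the test fields `⟪eⱼ, y⟫ψ`);
* tools: `integrableOn_norm_mul_norm`, `fderiv_innerConst_smul_apply`, `isTestFunctionOn_innerConst_smul`.

WHAT THIS IS NOT: not NS, not E, not the stub — a weak-class TOOL (`--supports` stmt-19832).
[folklore; cf. ConstantinIgnatovaVicol2026Putative §3.1.1 (3.3); Serrin 1963 §4]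
-/

noncomputable section

set_option linter.dupNamespace false
-- nested operator types (`innerSL … ∘L …`)
set_option maxSynthPendingDepth 3

open MeasureTheory Set Filter Topology Metric Function TopologicalSpace
open scoped ENNReal NNReal RealInnerProductSpace ContDiff

namespace Summit.NavierStokesRegularity.NavierStokesRegularity.Theorems.PowerGaugeEulerLiouville

open Literature.Analysis Literature.Analysis.FunctionSpaces Literature.Analysis.FluidPDE

namespace WeakPressure

variable {V : EuclideanSpace ℝ (Fin 3) → EuclideanSpace ℝ (Fin 3)} {P : EuclideanSpace ℝ (Fin 3) → ℝ}
  {G : EuclideanSpace ℝ (Fin 3) → EuclideanSpace ℝ (Fin 3) →L[ℝ] EuclideanSpace ℝ (Fin 3)}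

/-! ## Integrability helpers -/

/-- `‖G‖·‖V‖ ∈ L¹(B_R)` from `G ∈ L²(B_R)`, `V ∈ L²(B_R)` (Hölder). [folklore] -/
theorem integrableOn_norm_mul_norm {R : ℝ}
    (hG2 : MemLp G 2 (volume.restrict (ball (0 : EuclideanSpace ℝ (Fin 3)) R)))
    (hV2 : MemLp V 2 (volume.restrict (ball (0 : EuclideanSpace ℝ (Fin 3)) R))) :
    IntegrableOn (fun x => ‖G x‖ * ‖V x‖) (ball (0 : EuclideanSpace ℝ (Fin 3)) R) volume := by
  have h := MemLp.mul (p := 2) (q := 2) (r := 1) hV2.norm hG2.norm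
  have h' : MemLp (fun x => ‖G x‖ * ‖V x‖) 1 (volume.restrict (ball (0 : EuclideanSpace ℝ (Fin 3)) R)) := by
    simpa [Pi.mul_def, mul_comm] using h
  exact memLp_one_iff_integrable.1 h'

/-! ## (N1) the convective term with two rough factors -/

/-- **(N1) `∫⟪V, Dψ(V)⟫ = −∫⟪G(V), ψ⟫`** for `V ∈ L⁶_loc` weakly divergence free with whole-space weak gradient `G ∈ L²_loc` and a
test field `ψ`: the local Serrin skew identity of the tree (`integral_fderiv_apply_mul_inner_add_eq_zero`, `b = c = V`, `d ≡ eₖ`,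
`φ = ⟪eₖ, ψ⟫`) summed over an orthonormal frame `eₖ`. [folklore; Serrin 1963 §4] -/
theorem integral_inner_fderiv_apply_self (hVm : AEStronglyMeasurable V volume)
    (hV6 : ∀ r : ℝ, MemLp V 6 (volume.restrict (ball (0 : EuclideanSpace ℝ (Fin 3)) r)))
    (hVG : HasWeakFDerivOn (⊤ : Opens (EuclideanSpace ℝ (Fin 3))) volume V G)
    (hG2 : ∀ r : ℝ, MemLp G 2 (volume.restrict (ball (0 : EuclideanSpace ℝ (Fin 3)) r)))
    (hdiv : IsWeaklyDivFree V)
    {ψ : EuclideanSpace ℝ (Fin 3) → EuclideanSpace ℝ (Fin 3)} (hψ : IsTestFunctionOn (⊤ : Opens (EuclideanSpace ℝ (Fin 3))) ψ) :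
    ∫ x, ⟪V x, fderiv ℝ ψ x (V x)⟫ = -∫ x, ⟪G x (V x), ψ x⟫ := by
  -- ### supports
  obtain ⟨R₀, hR₀⟩ := hψ.hasCompactSupport.isCompact.isBounded.subset_ball (0 : EuclideanSpace ℝ (Fin 3))
  set R : ℝ := max R₀ 1 with hRdef
  have hR0 : 0 < R := lt_of_lt_of_le one_pos (le_max_right _ _)
  set K : Set (EuclideanSpace ℝ (Fin 3)) := tsupport ψ with hKdef
  have hKc : IsCompact K := hψ.hasCompactSupport
  have hKm : MeasurableSet K := (isClosed_tsupport ψ).measurableSet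
  set B : Set (EuclideanSpace ℝ (Fin 3)) := ball (0 : EuclideanSpace ℝ (Fin 3)) R with hBdef
  have hKB : K ⊆ B := hR₀.trans (ball_subset_ball (le_max_left _ _))
  set U : Opens (EuclideanSpace ℝ (Fin 3)) := ⟨B, isOpen_ball⟩ with hUdef
  haveI hBfin : IsFiniteMeasure ((volume : Measure (EuclideanSpace ℝ (Fin 3))).restrict B) :=
    isFiniteMeasure_restrict.2 measure_ball_lt_top.ne
  haveI hB2fin : IsFiniteMeasure ((volume : Measure (EuclideanSpace ℝ (Fin 3))).restrict (ball 0 (R + 2))) :=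
    isFiniteMeasure_restrict.2 measure_ball_lt_top.ne
  have hψd : Differentiable ℝ ψ := hψ.contDiff.differentiable (by simp)
  have hψc : Continuous ψ := hψ.contDiff.continuous
  have hDψc : Continuous (fderiv ℝ ψ) := hψ.contDiff.continuous_fderiv (by simp)
  have hψK : ∀ x, x ∉ K → ψ x = 0 := fun x hx => image_eq_zero_of_notMem_tsupport hx
  have hDψK : ∀ x, x ∉ K → fderiv ℝ ψ x = 0 := fun x hx => fderiv_of_notMem_tsupport ℝ hx
  obtain ⟨C₀, hC₀⟩ := hψc.bounded_above_of_compact_support hψ.hasCompactSupport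
  obtain ⟨C₁, hC₁⟩ := hDψc.bounded_above_of_compact_support (hψ.hasCompactSupport.fderiv (𝕜 := ℝ))
  have hC₀0 : 0 ≤ C₀ := (norm_nonneg _).trans (hC₀ 0)
  have hC₁0 : 0 ≤ C₁ := (norm_nonneg _).trans (hC₁ 0)
  -- ### data on the ball
  have hV6B : MemLp V 6 (volume.restrict B) := hV6 R
  have hV2B : MemLp V 2 (volume.restrict B) := hV6B.mono_exponent (by norm_num)
  have hG2B : MemLp G 2 (volume.restrict B) := hG2 R
  have hb3 : eLpNorm ((ball (0 : EuclideanSpace ℝ (Fin 3)) (R + 2)).indicator V) 3 volume < ⊤ := by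
    rw [eLpNorm_indicator_eq_eLpNorm_restrict measurableSet_ball]
    exact ((hV6 (R + 2)).mono_exponent (by norm_num : (3 : ℝ≥0∞) ≤ 6)).eLpNorm_lt_top
  have hVGU : HasWeakFDerivOn U volume V G := HasWeakFDerivOn.mono_set_holds hVG le_top
  have hV2K : IntegrableOn (fun x => ‖V x‖ ^ 2) K volume :=
    IntegrableOn.mono_set (show IntegrableOn (fun x => ‖V x‖ ^ 2) B volume from
      hV2B.integrable_norm_pow (by norm_num)) hKB
  have hGVK : IntegrableOn (fun x => ‖G x‖ * ‖V x‖) K volume := (integrableOn_norm_mul_norm hG2B hV2B).mono_set hKB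
  -- ### the frame and the component identities
  set e := stdOrthonormalBasis ℝ (EuclideanSpace ℝ (Fin 3)) with hedef
  set φ : Fin (Module.finrank ℝ (EuclideanSpace ℝ (Fin 3))) → EuclideanSpace ℝ (Fin 3) → ℝ :=
    fun k x => ⟪e k, ψ x⟫ with hφdef
  have hφtop : ∀ k, IsTestFunctionOn (⊤ : Opens (EuclideanSpace ℝ (Fin 3))) (φ k) := fun k => hψ.inner_const_left (e k)
  have hφU : ∀ k, IsTestFunctionOn U (φ k) := fun k =>
    ⟨(hφtop k).contDiff, (hφtop k).hasCompactSupport,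
      (closure_mono (Function.support_comp_subset (g := fun w : EuclideanSpace ℝ (Fin 3) => ⟪e k, w⟫)
        (by simp) ψ)).trans hKB⟩
  have hφderiv : ∀ k x v, fderiv ℝ (φ k) x v = ⟪e k, fderiv ℝ ψ x v⟫ := fun k x v =>
    fderiv_inner_const_left_apply hψd (e k) x v
  have hconst : ∀ k, HasWeakFDerivOn U volume (fun _ : EuclideanSpace ℝ (Fin 3) => e k)
      (fun _ => (0 : EuclideanSpace ℝ (Fin 3) →L[ℝ] EuclideanSpace ℝ (Fin 3))) := fun k => by
    have h := HasWeakFDerivOn.of_contDiff_holds U (volume : Measure (EuclideanSpace ℝ (Fin 3)))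
      (f := fun _ : EuclideanSpace ℝ (Fin 3) => e k) contDiff_const
    have e0 : (fderiv ℝ fun _ : EuclideanSpace ℝ (Fin 3) => e k) =
        fun _ => (0 : EuclideanSpace ℝ (Fin 3) →L[ℝ] EuclideanSpace ℝ (Fin 3)) := by
      funext x; exact fderiv_const_apply _
    rw [e0] at h
    exact h
  have hGl : LocallyIntegrable G volume := locallyIntegrableOn_univ.1 (by
    simpa only [Opens.coe_top] using hVG.locallyIntegrableOn_deriv)
  have hGm : AEStronglyMeasurable G volume := hGl.aestronglyMeasurable
  have hconst6 : ∀ k, MemLp (fun _ : EuclideanSpace ℝ (Fin 3) => e k) 6 (volume.restrict B) := fun k => memLp_const _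
  have hzero2 : MemLp (fun _ : EuclideanSpace ℝ (Fin 3) => (0 : EuclideanSpace ℝ (Fin 3) →L[ℝ] EuclideanSpace ℝ (Fin 3))) 2
      (volume.restrict B) := memLp_const _
  have hk : ∀ k, (∫ x, fderiv ℝ (φ k) x (V x) * ⟪V x, e k⟫) + ∫ x, φ k x * ⟪e k, G x (V x)⟫ = 0 := by
    intro k
    have h := integral_fderiv_apply_mul_inner_add_eq_zero (x₀ := (0 : EuclideanSpace ℝ (Fin 3))) (ρ := R)
      hdiv hVm hb3 hVGU (hconst k) hV6B (hconst6 k) hG2B hzero2 (hφU k)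
    simpa using h
  -- ### integrability of the summands
  have hI1 : ∀ k, Integrable (fun x => fderiv ℝ (φ k) x (V x) * ⟪V x, e k⟫) volume := by
    intro k
    refine ProfileEnergy.integrable_of_abs_le_on hKm ?_ hV2K (C := C₁) (fun x _ => ?_) (fun x hx => ?_)
    · exact (ProfileEnergy.aestronglyMeasurable_clm_apply
        (((hφtop k).contDiff.continuous_fderiv (by simp)).aestronglyMeasurable) hVm).mul
        (hVm.inner aestronglyMeasurable_const)
    · rw [hφderiv, abs_mul, abs_of_nonneg (by positivity : (0 : ℝ) ≤ ‖V x‖ ^ 2)]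
      calc |⟪e k, fderiv ℝ ψ x (V x)⟫| * |⟪V x, e k⟫| ≤ (‖e k‖ * ‖fderiv ℝ ψ x (V x)‖) * (‖V x‖ * ‖e k‖) :=
            mul_le_mul (abs_real_inner_le_norm _ _) (abs_real_inner_le_norm _ _) (abs_nonneg _) (by positivity)
        _ ≤ (1 * (C₁ * ‖V x‖)) * (‖V x‖ * 1) := by
            rw [e.orthonormal.1 k]
            refine mul_le_mul (mul_le_mul_of_nonneg_left ?_ zero_le_one) le_rfl (by positivity) (by positivity)
            exact ((fderiv ℝ ψ x).le_opNorm _).trans (mul_le_mul_of_nonneg_right (hC₁ x) (norm_nonneg _))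
        _ = C₁ * ‖V x‖ ^ 2 := by ring
    · rw [hφderiv, hDψK x hx]; simp
  have hI2 : ∀ k, Integrable (fun x => φ k x * ⟪e k, G x (V x)⟫) volume := by
    intro k
    refine ProfileEnergy.integrable_of_abs_le_on hKm ?_ hGVK (C := C₀) (fun x _ => ?_) (fun x hx => ?_)
    · exact (hφtop k).contDiff.continuous.aestronglyMeasurable.mul
        (aestronglyMeasurable_const.inner (ProfileEnergy.aestronglyMeasurable_clm_apply hGm hVm))
    · rw [abs_mul, abs_of_nonneg (by positivity : (0 : ℝ) ≤ ‖G x‖ * ‖V x‖)]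
      calc |φ k x| * |⟪e k, G x (V x)⟫| ≤ (‖e k‖ * ‖ψ x‖) * (‖e k‖ * ‖G x (V x)‖) :=
            mul_le_mul (abs_real_inner_le_norm _ _) (abs_real_inner_le_norm _ _) (abs_nonneg _) (by positivity)
        _ ≤ (1 * C₀) * (1 * (‖G x‖ * ‖V x‖)) := by
            rw [e.orthonormal.1 k, one_mul, one_mul, one_mul, one_mul]
            exact mul_le_mul (hC₀ x) ((G x).le_opNorm _) (norm_nonneg _) hC₀0
        _ = C₀ * (‖G x‖ * ‖V x‖) := by ring
    · simp [hφdef, hψK x hx]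
  -- ### Parseval, pointwise
  have hleft : ∀ x, ⟪V x, fderiv ℝ ψ x (V x)⟫ = ∑ k, fderiv ℝ (φ k) x (V x) * ⟪V x, e k⟫ := by
    intro x
    rw [← e.sum_inner_mul_inner (V x) (fderiv ℝ ψ x (V x))]
    exact Finset.sum_congr rfl fun k _ => by rw [hφderiv, mul_comm]
  have hright : ∀ x, ⟪G x (V x), ψ x⟫ = ∑ k, φ k x * ⟪e k, G x (V x)⟫ := by
    intro x
    rw [real_inner_comm, ← e.sum_inner_mul_inner (ψ x) (G x (V x))]
    exact Finset.sum_congr rfl fun k _ => by simp only [hφdef]; rw [real_inner_comm (e k) (ψ x)]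
  simp_rw [hleft, hright]
  rw [integral_finsetSum _ fun k _ => hI1 k, integral_finsetSum _ fun k _ => hI2 k, ← Finset.sum_neg_distrib]
  exact Finset.sum_congr rfl fun k _ => by linarith [hk k]

/-! ## (N2) the dilation term -/

/-- `D(⟪c, ·⟫ ψ)(x) v = ⟪c, v⟫ ψ(x) + ⟪c, x⟫ Dψ(x) v`. [folklore] -/
theorem fderiv_innerConst_smul_apply {ψ : EuclideanSpace ℝ (Fin 3) → EuclideanSpace ℝ (Fin 3)} (hψd : Differentiable ℝ ψ)
    (c x v : EuclideanSpace ℝ (Fin 3)) :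
    fderiv ℝ (fun y => ⟪c, y⟫ • ψ y) x v = ⟪c, v⟫ • ψ x + ⟪c, x⟫ • fderiv ℝ ψ x v := by
  have h1 : HasFDerivAt (fun y : EuclideanSpace ℝ (Fin 3) => ⟪c, y⟫) (innerSL ℝ c) x := (innerSL ℝ c).hasFDerivAt
  have hσd : Differentiable ℝ (fun y : EuclideanSpace ℝ (Fin 3) => ⟪c, y⟫) := (innerSL ℝ c).differentiable
  rw [ProfileEnergy.fderiv_smul_apply_of_differentiable hσd hψd, h1.fderiv, innerSL_apply_apply]

/-- `⟪c, ·⟫ ψ` is a test field when `ψ` is. [folklore] -/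
theorem isTestFunctionOn_innerConst_smul {ψ : EuclideanSpace ℝ (Fin 3) → EuclideanSpace ℝ (Fin 3)}
    (hψ : IsTestFunctionOn (⊤ : Opens (EuclideanSpace ℝ (Fin 3))) ψ) (c : EuclideanSpace ℝ (Fin 3)) :
    IsTestFunctionOn (⊤ : Opens (EuclideanSpace ℝ (Fin 3))) (fun y => ⟪c, y⟫ • ψ y) :=
  ⟨(contDiff_const.inner ℝ contDiff_id).smul hψ.contDiff,
    HasCompactSupport.intro hψ.hasCompactSupport fun y hy => by
      rw [image_eq_zero_of_notMem_tsupport hy, smul_zero],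
    fun _ _ => trivial⟩

/-- **(N2) `∫⟪V, Dψ(y)⟫ = −3∫⟪V, ψ⟫ − ∫⟪G(y), ψ⟫`** for `V` with whole-space weak gradient `G` and a test field `ψ`
(`⟪eⱼ, y⟫ψ` is a test field with `∂_{eⱼ}(⟪eⱼ,y⟫ψ) = ψ + ⟪eⱼ,y⟫∂_{eⱼ}ψ`, and `∫⟪V, ∂_{eⱼ}(⟪eⱼ,y⟫ψ)⟫ = −∫⟪G eⱼ, ⟪eⱼ,y⟫ψ⟫`;
sum over an orthonormal frame). [folklore] -/
theorem integral_inner_fderiv_apply_id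
    (hVG : HasWeakFDerivOn (⊤ : Opens (EuclideanSpace ℝ (Fin 3))) volume V G)
    {ψ : EuclideanSpace ℝ (Fin 3) → EuclideanSpace ℝ (Fin 3)} (hψ : IsTestFunctionOn (⊤ : Opens (EuclideanSpace ℝ (Fin 3))) ψ) :
    ∫ x, ⟪V x, fderiv ℝ ψ x x⟫ = -3 * (∫ x, ⟪V x, ψ x⟫) - ∫ x, ⟪G x x, ψ x⟫ := by
  have hVl : LocallyIntegrable V volume := locallyIntegrableOn_univ.1 (by
    simpa only [Opens.coe_top] using hVG.locallyIntegrableOn)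
  have hGl : LocallyIntegrable G volume := locallyIntegrableOn_univ.1 (by
    simpa only [Opens.coe_top] using hVG.locallyIntegrableOn_deriv)
  have hGm : AEStronglyMeasurable G volume := hGl.aestronglyMeasurable
  have hψd : Differentiable ℝ ψ := hψ.contDiff.differentiable (by simp)
  have hψc : Continuous ψ := hψ.contDiff.continuous
  set K : Set (EuclideanSpace ℝ (Fin 3)) := tsupport ψ with hKdef
  have hKc : IsCompact K := hψ.hasCompactSupport
  have hKm : MeasurableSet K := (isClosed_tsupport ψ).measurableSet
  obtain ⟨R₀, hR₀⟩ := hKc.isBounded.subset_ball (0 : EuclideanSpace ℝ (Fin 3))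
  set R : ℝ := max R₀ 1 with hRdef
  have hR0 : 0 ≤ R := le_trans zero_le_one (le_max_right _ _)
  have hxK : ∀ x ∈ K, ‖x‖ ≤ R := fun x hx => by
    have := (hR₀.trans (ball_subset_ball (le_max_left R₀ 1))) hx
    rw [mem_ball, dist_zero_right] at this; exact this.le
  have hψK : ∀ x, x ∉ K → ψ x = 0 := fun x hx => image_eq_zero_of_notMem_tsupport hx
  obtain ⟨C₀, hC₀⟩ := hψc.bounded_above_of_compact_support hψ.hasCompactSupport
  have hC₀0 : 0 ≤ C₀ := (norm_nonneg _).trans (hC₀ 0)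
  have hG1K : IntegrableOn (fun x => ‖G x‖) K volume := (hGl.integrableOn_isCompact hKc).norm
  -- ### the frame and the test fields `⟪eⱼ, y⟫ ψ`
  set e := stdOrthonormalBasis ℝ (EuclideanSpace ℝ (Fin 3)) with hedef
  have hWt : ∀ j, IsTestFunctionOn (⊤ : Opens (EuclideanSpace ℝ (Fin 3))) (fun y => ⟪e j, y⟫ • ψ y) := fun j =>
    isTestFunctionOn_innerConst_smul hψ (e j)
  have hWderiv : ∀ j x, fderiv ℝ (fun y => ⟪e j, y⟫ • ψ y) x (e j) = ψ x + ⟪e j, x⟫ • fderiv ℝ ψ x (e j) := by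
    intro j x
    rw [fderiv_innerConst_smul_apply hψd]
    have h1 : ⟪e j, e j⟫ = (1 : ℝ) := by
      rw [real_inner_self_eq_norm_sq, e.orthonormal.1 j, one_pow]
    rw [h1, one_smul]
  have hj : ∀ j, ∫ x, ⟪V x, fderiv ℝ (fun y => ⟪e j, y⟫ • ψ y) x (e j)⟫ = -∫ x, ⟪G x (e j), ⟪e j, x⟫ • ψ x⟫ :=
    fun j => HasWeakGradient.integral_inner_fderiv_apply_test hVG (hWt j) (e j)
  have hsumx : ∀ x : EuclideanSpace ℝ (Fin 3), ∑ j, ⟪e j, x⟫ • e j = x := fun x => e.sum_repr' x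
  -- ### pointwise expansions
  have hleft : ∀ x, ⟪V x, fderiv ℝ ψ x x⟫ =
      ∑ j, (⟪V x, fderiv ℝ (fun y => ⟪e j, y⟫ • ψ y) x (e j)⟫ - ⟪V x, ψ x⟫) := by
    intro x
    have h1 : ∑ j, ⟪e j, x⟫ • fderiv ℝ ψ x (e j) = fderiv ℝ ψ x x :=
      calc ∑ j, ⟪e j, x⟫ • fderiv ℝ ψ x (e j) = ∑ j, fderiv ℝ ψ x (⟪e j, x⟫ • e j) :=
            Finset.sum_congr rfl fun j _ => by rw [map_smul]
        _ = fderiv ℝ ψ x (∑ j, ⟪e j, x⟫ • e j) := (map_sum _ _ _).symm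
        _ = fderiv ℝ ψ x x := by rw [hsumx]
    rw [← h1, inner_sum]
    refine Finset.sum_congr rfl fun j _ => ?_
    rw [hWderiv j x, inner_add_right, add_sub_cancel_left]
  have hright : ∀ x, ⟪G x x, ψ x⟫ = ∑ j, ⟪G x (e j), ⟪e j, x⟫ • ψ x⟫ := by
    intro x
    symm
    calc ∑ j, ⟪G x (e j), ⟪e j, x⟫ • ψ x⟫ = ∑ j, ⟪G x (⟪e j, x⟫ • e j), ψ x⟫ :=
          Finset.sum_congr rfl fun j _ => by rw [map_smul, real_inner_smul_left, real_inner_smul_right]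
      _ = ⟪G x (∑ j, ⟪e j, x⟫ • e j), ψ x⟫ := by rw [map_sum, sum_inner]
      _ = ⟪G x x, ψ x⟫ := by rw [hsumx]
  -- ### integrability
  have hIψ : Integrable (fun x => ⟪V x, ψ x⟫) volume :=
    integrable_inner_of_locallyIntegrable_of_hasCompactSupport hVl hψc hψ.hasCompactSupport
  have hIW : ∀ j, Integrable (fun x => ⟪V x, fderiv ℝ (fun y => ⟪e j, y⟫ • ψ y) x (e j)⟫) volume := by
    intro j
    have hc : Continuous fun x => fderiv ℝ (fun y => ⟪e j, y⟫ • ψ y) x (e j) :=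
      ((hWt j).contDiff.continuous_fderiv (by simp)).clm_apply continuous_const
    exact integrable_inner_of_locallyIntegrable_of_hasCompactSupport hVl hc
      ((hWt j).hasCompactSupport.fderiv_apply (𝕜 := ℝ) (e j))
  have hIG : ∀ j, Integrable (fun x => ⟪G x (e j), ⟪e j, x⟫ • ψ x⟫) volume := by
    intro j
    refine ProfileEnergy.integrable_of_abs_le_on hKm ?_ hG1K (C := R * C₀) (fun x hx => ?_) (fun x hx => ?_)
    · exact (ProfileEnergy.aestronglyMeasurable_clm_apply hGm aestronglyMeasurable_const).inner
        (hWt j).contDiff.continuous.aestronglyMeasurable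
    · rw [abs_norm, inner_smul_right, abs_mul]
      calc |⟪e j, x⟫| * |⟪G x (e j), ψ x⟫| ≤ (‖e j‖ * ‖x‖) * (‖G x (e j)‖ * ‖ψ x‖) :=
            mul_le_mul (abs_real_inner_le_norm _ _) (abs_real_inner_le_norm _ _) (abs_nonneg _) (by positivity)
        _ ≤ (1 * R) * ((‖G x‖ * ‖e j‖) * C₀) :=
            mul_le_mul (mul_le_mul (le_of_eq (e.orthonormal.1 j)) (hxK x hx) (norm_nonneg _) zero_le_one)
              (mul_le_mul ((G x).le_opNorm _) (hC₀ x) (norm_nonneg _) (by positivity)) (by positivity) (by positivity)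
        _ = R * C₀ * ‖G x‖ := by rw [e.orthonormal.1 j]; ring
    · rw [hψK x hx, smul_zero, inner_zero_right]
  -- ### assemble
  have h3 : (Finset.univ : Finset (Fin (Module.finrank ℝ (EuclideanSpace ℝ (Fin 3))))).card = 3 := by
    rw [Finset.card_univ, Fintype.card_fin, finrank_euclideanSpace_fin]
  have hIWsub : ∀ j, Integrable (fun x => ⟪V x, fderiv ℝ (fun y => ⟪e j, y⟫ • ψ y) x (e j)⟫ - ⟪V x, ψ x⟫) volume :=
    fun j => (hIW j).sub hIψ
  rw [integral_congr_ae (Eventually.of_forall hleft), integral_congr_ae (Eventually.of_forall hright),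
    integral_finsetSum _ fun j _ => hIWsub j, integral_finsetSum _ fun j _ => hIG j]
  have hterm : ∀ j, ∫ x, (⟪V x, fderiv ℝ (fun y => ⟪e j, y⟫ • ψ y) x (e j)⟫ - ⟪V x, ψ x⟫) =
      -(∫ x, ⟪G x (e j), ⟪e j, x⟫ • ψ x⟫) - ∫ x, ⟪V x, ψ x⟫ := fun j => by
    rw [integral_sub (hIW j) hIψ, hj j]
  rw [Finset.sum_congr rfl fun j _ => hterm j, Finset.sum_sub_distrib, Finset.sum_neg_distrib, Finset.sum_const, h3]
  simp only [nsmul_eq_mul, Nat.cast_ofNat]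
  ring

end WeakPressure

end Summit.NavierStokesRegularity.NavierStokesRegularity.Theorems.PowerGaugeEulerLiouville
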